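import Mathlib
import HarnessLib
import Summits.Ventures.LatticeQCDFlow.Exactness.LatticeSecondMomentFloor
import Summits.Ventures.LatticeQCDFlow.Exactness.LatticeCoordAvgProducts

/-!
# Block tensorization of the second moment of a log-weight: `(∫e^{−(Σ_j h_j + r)})²·exp(Σ_j e^{−4M_j}Var(A_C h_j)/(1 + M_j²)) ≤ ∫e^{−2(Σ_j h_j + r)}` for block-local `h_j` with disjoint dependence sets and a corridor term `r`

HONEST FRAMING: exact (Metropolis-corrected) sampling algorithms for lattice gauge theory;
figures of merit are autocorrelation/cost numbers at stated couplings and volumes; no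
continuum-physics claim.

Venture `LatticeQCDFlow` (cell pub-lqcd), topic `Exactness`; FANOUT row 7 (`s0-cpn-null`).  NEW WORK
of the cell over this lineage's `Exactness/LatticeSecondMomentFloor.lean` (the one-block second-moment
floor in conditional form, the weighted Cauchy–Schwarz inequality, the conditional-variance bound and the
interaction-variance inequality) and `Exactness/LatticeCoordAvgProducts.lean` (conditional independence
of disjoint blocks under `A_s`), with the tree's `Exactness/LatticeCoordAvg.lean`; nothing is cited as a
fact.  Printed counterpart, NAMED ONLY: Abbott et al., Phys. Rev. D 106 (2022) 074506, §V ("for fixed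
models the effective sample size degrades exponentially in the volume").  THE MECHANISM AS A THEOREM:
the SECOND MOMENT of the importance weights `w = e^{−F}` of a sampler whose log-weight is a sum of
block-local terms TENSORIZES MULTIPLICATIVELY.  On a finite product of compact probability spaces, for
pairwise disjoint dependence sets `D_j ⊇ B_j` (`j ∈ T`), `h_j` continuous depending on `D_j` with
oscillation `≤ M_j`, and `r` continuous depending on the corridor `C = (⋃_j B_j)ᶜ`:
`(∫e^{−(Σ_j h_j + r)}dπ)² · exp(Σ_j e^{−4M_j}·Var_π(A_C h_j)/(1 + M_j²)) ≤ ∫e^{−2(Σ_j h_j + r)}dπ` —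
the effective-sample-size fraction `(∫w)²/∫w²` is at most a product over blocks of factors
`exp(−e^{−4M_j}Var(A_C h_j)/(1+M_j²)) < 1`.  Proof: condition on the corridor by the coordinate average
`A_B` over `B = ⋃B_j`; factorize `A_B e^{−Σh_j} = Π_j A_B e^{−h_j}`; one-block floor
`A_B e^{−2h_j} ≥ (A_B e^{−h_j})²(1 + u_j)`, `u_j = e^{−4M_j}(A_B(h_j²) − (A_B h_j)²)`; weighted
Cauchy–Schwarz against `U = Π_j(1 + u_j)`; `∫U⁻¹ = Π_j∫(1+u_j)⁻¹` (the `u_j` read the disjoint `D_j`);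
`∫(1+u_j)⁻¹ ≤ 1 − ∫u_j/(1 + M_j²) ≤ exp(−∫u_j/(1+M_j²))`; `∫u_j ≥ e^{−4M_j}Var(A_C h_j)`.

## Content

* **`sq_integral_exp_neg_blockSum_mul_exp_le`** — THE TENSORIZED SECOND-MOMENT FLOOR;
* **`sq_integral_exp_neg_mul_exp_le_of_abs_sub_le`** — the same for any continuous `F` with
  `|F − (Σ_j h_j + r)| ≤ δ`, at the price `e^{4δ}`.

NOT CLAIMED: anything about flows or specific models (see the sphere-side sequel); numbers.
-/

noncomputable section

namespace Summit.Ventures.LatticeQCDFlow.Exactness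

open MeasureTheory Function
open scoped ENNReal

variable {ι : Type*} [Fintype ι] [DecidableEq ι]
variable {X : Type*} [MeasurableSpace X] [MetricSpace X] [CompactSpace X] [BorelSpace X]
  (μ : Measure X) [IsProbabilityMeasure μ]

/-- **THE TENSORIZED SECOND-MOMENT FLOOR.**  Blocks `B_j ⊆ D_j` with the `D_j` pairwise disjoint
(`j ∈ T`); `h_j` continuous, depending on `D_j`, with oscillation `≤ M_j` (`0 ≤ M_j`); `r` continuous
depending on the complement of `B = ⋃_j B_j`; `C = univ ∖ B`.  Then
`(∫e^{−(Σ_j h_j + r)})² · exp(Σ_j e^{−4M_j}·∫(A_C h_j − ∫h_j)²/(1 + M_j²)) ≤ ∫e^{−2(Σ_j h_j + r)}`. -/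
theorem sq_integral_exp_neg_blockSum_mul_exp_le {J : Type*} (T : Finset J) (B D : J → Finset ι)
    (hBD : ∀ j ∈ T, B j ⊆ D j) (hD : ∀ j ∈ T, ∀ j' ∈ T, j ≠ j' → Disjoint (D j) (D j'))
    {h : J → (ι → X) → ℝ} (hc : ∀ j ∈ T, Continuous (h j)) (hdep : ∀ j ∈ T, DependsOn (h j) ↑(D j))
    {M : J → ℝ} (hM0 : ∀ j ∈ T, 0 ≤ M j) (hM : ∀ j ∈ T, ∀ ω ω', |h j ω - h j ω'| ≤ M j)
    {r : (ι → X) → ℝ} (hr : Continuous r) (hrdep : DependsOn r (↑(T.biUnion B) : Set ι)ᶜ) :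
    (∫ ω, Real.exp (-(∑ j ∈ T, h j ω + r ω)) ∂Measure.pi (fun _ : ι => μ)) ^ 2 *
        Real.exp (∑ j ∈ T, Real.exp (-4 * M j) *
          (∫ ω, (coordAvg μ (Finset.univ \ T.biUnion B) (h j) ω -
              ∫ ω', h j ω' ∂Measure.pi (fun _ : ι => μ)) ^ 2 ∂Measure.pi (fun _ : ι => μ)) /
            (1 + M j ^ 2)) ≤
      ∫ ω, Real.exp (-2 * (∑ j ∈ T, h j ω + r ω)) ∂Measure.pi (fun _ : ι => μ) := by
  set π : Measure (ι → X) := Measure.pi (fun _ : ι => μ) with hπ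
  set s : Finset ι := T.biUnion B with hs
  -- bookkeeping: `D_j ⊆ B_j ∪ sᶜ`, pairwise disjoint `B_j`
  have hBdisj : ∀ j ∈ T, ∀ j' ∈ T, j ≠ j' → Disjoint (B j) (B j') := fun j hj j' hj' hne =>
    Finset.disjoint_of_subset_left (hBD j hj) (Finset.disjoint_of_subset_right (hBD j' hj') (hD j hj j' hj' hne))
  have hDsub : ∀ j ∈ T, (↑(D j) : Set ι) ⊆ ↑(B j) ∪ (↑s)ᶜ := by
    intro j hj i hi
    by_cases his : i ∈ s
    · left
      obtain ⟨j', hj', hij'⟩ := Finset.mem_biUnion.1 his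
      by_cases hjj : j = j'
      · subst hjj; exact hij'
      · exact absurd (Finset.disjoint_left.1 (hD j hj j' hj' hjj) (Finset.mem_coe.1 hi) (hBD j' hj' hij')) id
    · right; exact fun h' => his (Finset.mem_coe.1 h')
  have hdepD : ∀ j ∈ T, ∀ (φ : ℝ → ℝ), DependsOn (fun ω => φ (h j ω)) (↑(B j) ∪ (↑s)ᶜ) :=
    fun j hj φ ω₁ ω₂ hagree => congrArg φ (hdep j hj fun i hi => hagree i (hDsub j hj hi))
  -- continuity of the ingredients
  have hce : ∀ j ∈ T, Continuous fun ω => Real.exp (-h j ω) := fun j hj => (hc j hj).neg.rexp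
  have hce2 : ∀ j ∈ T, Continuous fun ω => Real.exp (-2 * h j ω) := fun j hj =>
    (continuous_const.mul (hc j hj)).rexp
  have hcz : ∀ j ∈ T, Continuous fun ω => coordAvg μ s (fun ω => Real.exp (-h j ω)) ω :=
    fun j hj => continuous_coordAvg μ s (hce j hj)
  have hcz2 : ∀ j ∈ T, Continuous fun ω => coordAvg μ s (fun ω => Real.exp (-2 * h j ω)) ω :=
    fun j hj => continuous_coordAvg μ s (hce2 j hj)
  have hcu : ∀ j ∈ T, Continuous fun ω => Real.exp (-4 * M j) *
      (coordAvg μ s (fun ω => h j ω ^ 2) ω - (coordAvg μ s (h j) ω) ^ 2) := fun j hj =>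
    continuous_const.mul ((continuous_coordAvg μ s ((hc j hj).pow 2)).sub ((continuous_coordAvg μ s (hc j hj)).pow 2))
  -- `u_j ≥ 0`, `u_j ≤ e^{−4M_j} M_j²`
  have hu0 : ∀ j ∈ T, ∀ ω, 0 ≤ Real.exp (-4 * M j) *
      (coordAvg μ s (fun ω => h j ω ^ 2) ω - (coordAvg μ s (h j) ω) ^ 2) := fun j hj ω =>
    mul_nonneg (Real.exp_pos _).le (sub_nonneg.2 (sq_coordAvg_le μ s (hc j hj) ω))
  have huW : ∀ j ∈ T, ∀ ω, Real.exp (-4 * M j) *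
      (coordAvg μ s (fun ω => h j ω ^ 2) ω - (coordAvg μ s (h j) ω) ^ 2) ≤ Real.exp (-4 * M j) * M j ^ 2 :=
    fun j hj ω => mul_le_mul_of_nonneg_left (coordAvg_sq_sub_sq_coordAvg_le μ s (hc j hj) (hM j hj) ω)
      (Real.exp_pos _).le
  have hupos : ∀ j ∈ T, ∀ ω, 0 < 1 + Real.exp (-4 * M j) *
      (coordAvg μ s (fun ω => h j ω ^ 2) ω - (coordAvg μ s (h j) ω) ^ 2) := fun j hj ω => by
    linarith [hu0 j hj ω]
  have hcinv : ∀ j ∈ T, Continuous fun ω => (1 + Real.exp (-4 * M j) *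
      (coordAvg μ s (fun ω => h j ω ^ 2) ω - (coordAvg μ s (h j) ω) ^ 2))⁻¹ := fun j hj =>
    (continuous_const.add (hcu j hj)).inv₀ fun ω => (hupos j hj ω).ne'
  -- factorization of the conditional first and second moments
  have hZ : ∀ ω, coordAvg μ s (fun ω => Real.exp (-(∑ j ∈ T, h j ω))) ω =
      ∏ j ∈ T, coordAvg μ s (fun ω => Real.exp (-h j ω)) ω := by
    intro ω
    have e : (fun ω : ι → X => Real.exp (-(∑ j ∈ T, h j ω))) = fun ω => ∏ j ∈ T, Real.exp (-h j ω) := by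
      funext ω; rw [← Finset.sum_neg_distrib, Real.exp_sum]
    rw [e]
    exact coordAvg_finset_prod_of_dependsOn μ T s B hBdisj hce (fun j hj => hdepD j hj fun t => Real.exp (-t)) ω
  have hZ2 : ∀ ω, coordAvg μ s (fun ω => Real.exp (-2 * ∑ j ∈ T, h j ω)) ω =
      ∏ j ∈ T, coordAvg μ s (fun ω => Real.exp (-2 * h j ω)) ω := by
    intro ω
    have e : (fun ω : ι → X => Real.exp (-2 * ∑ j ∈ T, h j ω)) = fun ω => ∏ j ∈ T, Real.exp (-2 * h j ω) := by
      funext ω; rw [Finset.mul_sum, Real.exp_sum]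
    rw [e]
    exact coordAvg_finset_prod_of_dependsOn μ T s B hBdisj hce2 (fun j hj => hdepD j hj fun t => Real.exp (-2 * t)) ω
  -- `r` is invariant under changes of the block coordinates
  have hrinv : ∀ ω ω', r (s.piecewise ω' ω) = r ω := fun ω ω' =>
    hrdep fun i hi => Finset.piecewise_eq_of_notMem _ _ _ fun his => hi (Finset.mem_coe.2 his)
  -- the two integrals through the conditional moments
  have hcS : Continuous fun ω => ∑ j ∈ T, h j ω := continuous_finsetSum T fun j hj => hc j hj
  have hI1 : ∫ ω, Real.exp (-(∑ j ∈ T, h j ω + r ω)) ∂π =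
      ∫ ω, Real.exp (-r ω) * ∏ j ∈ T, coordAvg μ s (fun ω => Real.exp (-h j ω)) ω ∂π := by
    have hcf : Continuous fun ω => Real.exp (-r ω) * Real.exp (-(∑ j ∈ T, h j ω)) := hr.neg.rexp.mul hcS.neg.rexp
    calc ∫ ω, Real.exp (-(∑ j ∈ T, h j ω + r ω)) ∂π
        = ∫ ω, Real.exp (-r ω) * Real.exp (-(∑ j ∈ T, h j ω)) ∂π := by
          refine integral_congr_ae (ae_of_all _ fun ω => ?_)
          show Real.exp (-(∑ j ∈ T, h j ω + r ω)) = Real.exp (-r ω) * Real.exp (-(∑ j ∈ T, h j ω))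
          rw [← Real.exp_add]; ring_nf
      _ = ∫ ω, coordAvg μ s (fun ω => Real.exp (-r ω) * Real.exp (-(∑ j ∈ T, h j ω))) ω ∂π :=
          (integral_coordAvg μ s hcf).symm
      _ = ∫ ω, Real.exp (-r ω) * ∏ j ∈ T, coordAvg μ s (fun ω => Real.exp (-h j ω)) ω ∂π := by
          refine integral_congr_ae (ae_of_all _ fun ω => ?_)
          show coordAvg μ s (fun ω => Real.exp (-r ω) * Real.exp (-(∑ j ∈ T, h j ω))) ω = _
          rw [coordAvg_mul_left μ s (fun ω ω' => by rw [hrinv]), hZ ω]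
  have hI2 : ∫ ω, Real.exp (-2 * (∑ j ∈ T, h j ω + r ω)) ∂π =
      ∫ ω, Real.exp (-2 * r ω) * ∏ j ∈ T, coordAvg μ s (fun ω => Real.exp (-2 * h j ω)) ω ∂π := by
    have hcf : Continuous fun ω => Real.exp (-2 * r ω) * Real.exp (-2 * ∑ j ∈ T, h j ω) :=
      (continuous_const.mul hr).rexp.mul (continuous_const.mul hcS).rexp
    calc ∫ ω, Real.exp (-2 * (∑ j ∈ T, h j ω + r ω)) ∂π
        = ∫ ω, Real.exp (-2 * r ω) * Real.exp (-2 * ∑ j ∈ T, h j ω) ∂π := by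
          refine integral_congr_ae (ae_of_all _ fun ω => ?_)
          show Real.exp (-2 * (∑ j ∈ T, h j ω + r ω)) = Real.exp (-2 * r ω) * Real.exp (-2 * ∑ j ∈ T, h j ω)
          rw [← Real.exp_add]; ring_nf
      _ = ∫ ω, coordAvg μ s (fun ω => Real.exp (-2 * r ω) * Real.exp (-2 * ∑ j ∈ T, h j ω)) ω ∂π :=
          (integral_coordAvg μ s hcf).symm
      _ = ∫ ω, Real.exp (-2 * r ω) * ∏ j ∈ T, coordAvg μ s (fun ω => Real.exp (-2 * h j ω)) ω ∂π := by
          refine integral_congr_ae (ae_of_all _ fun ω => ?_)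
          show coordAvg μ s (fun ω => Real.exp (-2 * r ω) * Real.exp (-2 * ∑ j ∈ T, h j ω)) ω = _
          rw [coordAvg_mul_left μ s (fun ω ω' => by rw [hrinv]), hZ2 ω]
  -- pointwise: `(Π z_j)²·Π(1+u_j) ≤ Π z2_j`
  have hprod : ∀ ω, (∏ j ∈ T, coordAvg μ s (fun ω => Real.exp (-h j ω)) ω) ^ 2 *
      (∏ j ∈ T, (1 + Real.exp (-4 * M j) *
        (coordAvg μ s (fun ω => h j ω ^ 2) ω - (coordAvg μ s (h j) ω) ^ 2))) ≤
      ∏ j ∈ T, coordAvg μ s (fun ω => Real.exp (-2 * h j ω)) ω := by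
    intro ω
    rw [← Finset.prod_pow, ← Finset.prod_mul_distrib]
    refine Finset.prod_le_prod (fun j hj => mul_nonneg (sq_nonneg _) (by linarith [hu0 j hj ω])) fun j hj => ?_
    exact sq_coordAvg_exp_neg_mul_le μ s (hc j hj) (hM j hj) ω
  -- the product `U = Π(1+u_j)` is continuous and positive
  have hcU : Continuous fun ω => ∏ j ∈ T, (1 + Real.exp (-4 * M j) *
      (coordAvg μ s (fun ω => h j ω ^ 2) ω - (coordAvg μ s (h j) ω) ^ 2)) :=
    continuous_finsetProd T fun j hj => continuous_const.add (hcu j hj)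
  have hUpos : ∀ ω, 0 < ∏ j ∈ T, (1 + Real.exp (-4 * M j) *
      (coordAvg μ s (fun ω => h j ω ^ 2) ω - (coordAvg μ s (h j) ω) ^ 2)) := fun ω =>
    Finset.prod_pos fun j hj => by linarith [hu0 j hj ω]
  -- Cauchy–Schwarz
  have hcφ : Continuous fun ω => Real.exp (-r ω) * ∏ j ∈ T, coordAvg μ s (fun ω => Real.exp (-h j ω)) ω :=
    hr.neg.rexp.mul (continuous_finsetProd T fun j hj => hcz j hj)
  have hCS := sq_integral_le_integral_sq_mul_mul_integral_inv μ hcφ hcU hUpos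
  -- `∫ φ²U ≤ ∫ e^{−2F̃}`
  have hφU : ∫ ω, (Real.exp (-r ω) * ∏ j ∈ T, coordAvg μ s (fun ω => Real.exp (-h j ω)) ω) ^ 2 *
      (∏ j ∈ T, (1 + Real.exp (-4 * M j) *
        (coordAvg μ s (fun ω => h j ω ^ 2) ω - (coordAvg μ s (h j) ω) ^ 2))) ∂π ≤
      ∫ ω, Real.exp (-2 * (∑ j ∈ T, h j ω + r ω)) ∂π := by
    rw [hI2]
    refine integral_mono (integrable_pi_of_continuous μ ((hcφ.pow 2).mul hcU))
      (integrable_pi_of_continuous μ ((continuous_const.mul hr).rexp.mul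
        (continuous_finsetProd T fun j hj => hcz2 j hj))) fun ω => ?_
    have e : (Real.exp (-r ω) * ∏ j ∈ T, coordAvg μ s (fun ω => Real.exp (-h j ω)) ω) ^ 2 *
        (∏ j ∈ T, (1 + Real.exp (-4 * M j) *
          (coordAvg μ s (fun ω => h j ω ^ 2) ω - (coordAvg μ s (h j) ω) ^ 2))) =
        Real.exp (-2 * r ω) * ((∏ j ∈ T, coordAvg μ s (fun ω => Real.exp (-h j ω)) ω) ^ 2 *
          ∏ j ∈ T, (1 + Real.exp (-4 * M j) *
            (coordAvg μ s (fun ω => h j ω ^ 2) ω - (coordAvg μ s (h j) ω) ^ 2))) := by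
      rw [mul_pow, ← Real.exp_nat_mul]; ring_nf
    rw [e]
    exact mul_le_mul_of_nonneg_left (hprod ω) (Real.exp_pos _).le
  -- `∫ U⁻¹ = Π_j ∫ (1+u_j)⁻¹ ≤ exp(−Σ_j x_j)`
  have hdepu : ∀ j ∈ T, DependsOn (fun ω => (1 + Real.exp (-4 * M j) *
      (coordAvg μ s (fun ω => h j ω ^ 2) ω - (coordAvg μ s (h j) ω) ^ 2))⁻¹)
      (↑(D j) ∪ (↑(Finset.univ : Finset ι))ᶜ) := by
    intro j hj ω₁ ω₂ hagree
    have h1 : coordAvg μ s (fun ω => h j ω ^ 2) ω₁ = coordAvg μ s (fun ω => h j ω ^ 2) ω₂ :=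
      dependsOn_coordAvg_of_dependsOn μ s (fun ω₁ ω₂ h' => by rw [hdep j hj h']) fun i hi => hagree i (Or.inl hi)
    have h2 : coordAvg μ s (h j) ω₁ = coordAvg μ s (h j) ω₂ :=
      dependsOn_coordAvg_of_dependsOn μ s (hdep j hj) fun i hi => hagree i (Or.inl hi)
    simp only [h1, h2]
  have hne : Nonempty (ι → X) := by
    by_contra hcon
    have h1 : π Set.univ = 1 := measure_univ
    rw [Set.univ_eq_empty_iff.mpr (not_nonempty_iff.mp hcon), measure_empty] at h1
    exact zero_ne_one h1
  obtain ⟨ω₀⟩ := hne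
  have hUinv : ∫ ω, (∏ j ∈ T, (1 + Real.exp (-4 * M j) *
      (coordAvg μ s (fun ω => h j ω ^ 2) ω - (coordAvg μ s (h j) ω) ^ 2)))⁻¹ ∂π =
      ∏ j ∈ T, ∫ ω, (1 + Real.exp (-4 * M j) *
        (coordAvg μ s (fun ω => h j ω ^ 2) ω - (coordAvg μ s (h j) ω) ^ 2))⁻¹ ∂π := by
    simp_rw [← Finset.prod_inv_distrib]
    have h := coordAvg_finset_prod_of_dependsOn μ T Finset.univ D hD hcinv hdepu ω₀
    simp only [coordAvg_univ] at h
    exact h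
  have hfac : ∀ j ∈ T, ∫ ω, (1 + Real.exp (-4 * M j) *
      (coordAvg μ s (fun ω => h j ω ^ 2) ω - (coordAvg μ s (h j) ω) ^ 2))⁻¹ ∂π ≤
      Real.exp (-(Real.exp (-4 * M j) *
        (∫ ω, (coordAvg μ (Finset.univ \ s) (h j) ω - ∫ ω', h j ω' ∂π) ^ 2 ∂π) / (1 + M j ^ 2))) := by
    intro j hj
    have hIu : Integrable (fun ω => Real.exp (-4 * M j) *
        (coordAvg μ s (fun ω => h j ω ^ 2) ω - (coordAvg μ s (h j) ω) ^ 2)) π :=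
      integrable_pi_of_continuous μ (hcu j hj)
    -- `∫(1+u)⁻¹ ≤ 1 − ∫u/(1+W)`
    have h1 : ∫ ω, (1 + Real.exp (-4 * M j) *
        (coordAvg μ s (fun ω => h j ω ^ 2) ω - (coordAvg μ s (h j) ω) ^ 2))⁻¹ ∂π ≤
        1 - (∫ ω, Real.exp (-4 * M j) *
          (coordAvg μ s (fun ω => h j ω ^ 2) ω - (coordAvg μ s (h j) ω) ^ 2) ∂π) /
            (1 + Real.exp (-4 * M j) * M j ^ 2) := by
      have hIinv : Integrable (fun ω => (1 + Real.exp (-4 * M j) *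
          (coordAvg μ s (fun ω => h j ω ^ 2) ω - (coordAvg μ s (h j) ω) ^ 2))⁻¹) π :=
        integrable_pi_of_continuous μ (hcinv j hj)
      have hIg : Integrable (fun ω => 1 - Real.exp (-4 * M j) *
          (coordAvg μ s (fun ω => h j ω ^ 2) ω - (coordAvg μ s (h j) ω) ^ 2) /
            (1 + Real.exp (-4 * M j) * M j ^ 2)) π := (integrable_const (1 : ℝ)).sub (hIu.div_const _)
      have hmono : ∫ ω, (1 + Real.exp (-4 * M j) *
          (coordAvg μ s (fun ω => h j ω ^ 2) ω - (coordAvg μ s (h j) ω) ^ 2))⁻¹ ∂π ≤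
          ∫ ω, (1 - Real.exp (-4 * M j) *
            (coordAvg μ s (fun ω => h j ω ^ 2) ω - (coordAvg μ s (h j) ω) ^ 2) /
              (1 + Real.exp (-4 * M j) * M j ^ 2)) ∂π :=
        integral_mono hIinv hIg fun ω => inv_one_add_le_one_sub_div (hu0 j hj ω) (huW j hj ω)
      rw [integral_sub (integrable_const _) (hIu.div_const _), integral_const, smul_eq_mul, probReal_univ,
        one_mul, integral_div] at hmono
      exact hmono
    -- `∫u = e^{−4M}(∫h² − ∫(A_s h)²) ≥ e^{−4M}·Var(A_C h)`
    have h2 : Real.exp (-4 * M j) *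
        (∫ ω, (coordAvg μ (Finset.univ \ s) (h j) ω - ∫ ω', h j ω' ∂π) ^ 2 ∂π) ≤
        ∫ ω, Real.exp (-4 * M j) *
          (coordAvg μ s (fun ω => h j ω ^ 2) ω - (coordAvg μ s (h j) ω) ^ 2) ∂π := by
      have hcsq : Continuous fun ω => h j ω ^ 2 := (hc j hj).pow 2
      have hIa : Integrable (fun ω => coordAvg μ s (fun ω => h j ω ^ 2) ω) π :=
        integrable_pi_of_continuous μ (continuous_coordAvg μ s hcsq)
      have hIb : Integrable (fun ω => (coordAvg μ s (h j) ω) ^ 2) π :=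
        integrable_pi_of_continuous μ ((continuous_coordAvg μ s (hc j hj)).pow 2)
      rw [integral_const_mul, integral_sub hIa hIb, integral_coordAvg μ s hcsq]
      exact mul_le_mul_of_nonneg_left (variance_coordAvg_sdiff_le_integral_sq_sub_coordAvg μ s (hc j hj))
        (Real.exp_pos _).le
    -- denominators: `1 + e^{−4M}M² ≤ 1 + M²`
    have hW : 1 + Real.exp (-4 * M j) * M j ^ 2 ≤ 1 + M j ^ 2 := by
      have : Real.exp (-4 * M j) ≤ 1 := Real.exp_le_one_iff.2 (by linarith [hM0 j hj])
      nlinarith [sq_nonneg (M j)]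
    have hV0 : 0 ≤ Real.exp (-4 * M j) *
        (∫ ω, (coordAvg μ (Finset.univ \ s) (h j) ω - ∫ ω', h j ω' ∂π) ^ 2 ∂π) :=
      mul_nonneg (Real.exp_pos _).le (integral_nonneg fun ω => sq_nonneg _)
    have h3 : Real.exp (-4 * M j) *
        (∫ ω, (coordAvg μ (Finset.univ \ s) (h j) ω - ∫ ω', h j ω' ∂π) ^ 2 ∂π) / (1 + M j ^ 2) ≤
        (∫ ω, Real.exp (-4 * M j) *
          (coordAvg μ s (fun ω => h j ω ^ 2) ω - (coordAvg μ s (h j) ω) ^ 2) ∂π) /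
            (1 + Real.exp (-4 * M j) * M j ^ 2) :=
      div_le_div₀ (hV0.trans h2) h2 (by positivity) hW
    refine h1.trans ((by linarith : _ ≤ _) |>.trans (Real.add_one_le_exp _))
  -- assemble
  have hU0 : ∀ j ∈ T, 0 ≤ ∫ ω, (1 + Real.exp (-4 * M j) *
      (coordAvg μ s (fun ω => h j ω ^ 2) ω - (coordAvg μ s (h j) ω) ^ 2))⁻¹ ∂π :=
    fun j hj => integral_nonneg fun ω => (inv_pos.2 (by linarith [hu0 j hj ω])).le
  have hUle : ∫ ω, (∏ j ∈ T, (1 + Real.exp (-4 * M j) *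
      (coordAvg μ s (fun ω => h j ω ^ 2) ω - (coordAvg μ s (h j) ω) ^ 2)))⁻¹ ∂π ≤
      Real.exp (-(∑ j ∈ T, Real.exp (-4 * M j) *
        (∫ ω, (coordAvg μ (Finset.univ \ s) (h j) ω - ∫ ω', h j ω' ∂π) ^ 2 ∂π) / (1 + M j ^ 2))) := by
    rw [hUinv, ← Finset.sum_neg_distrib, Real.exp_sum]
    exact Finset.prod_le_prod hU0 hfac
  have hE2 : 0 ≤ ∫ ω, Real.exp (-2 * (∑ j ∈ T, h j ω + r ω)) ∂π := integral_nonneg fun ω => (Real.exp_pos _).le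
  rw [hI1]
  calc (∫ ω, Real.exp (-r ω) * ∏ j ∈ T, coordAvg μ s (fun ω => Real.exp (-h j ω)) ω ∂π) ^ 2 *
        Real.exp (∑ j ∈ T, Real.exp (-4 * M j) *
          (∫ ω, (coordAvg μ (Finset.univ \ s) (h j) ω - ∫ ω', h j ω' ∂π) ^ 2 ∂π) / (1 + M j ^ 2))
      ≤ ((∫ ω, Real.exp (-2 * (∑ j ∈ T, h j ω + r ω)) ∂π) *
          ∫ ω, (∏ j ∈ T, (1 + Real.exp (-4 * M j) *
            (coordAvg μ s (fun ω => h j ω ^ 2) ω - (coordAvg μ s (h j) ω) ^ 2)))⁻¹ ∂π) *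
        Real.exp (∑ j ∈ T, Real.exp (-4 * M j) *
          (∫ ω, (coordAvg μ (Finset.univ \ s) (h j) ω - ∫ ω', h j ω' ∂π) ^ 2 ∂π) / (1 + M j ^ 2)) :=
        mul_le_mul_of_nonneg_right (hCS.trans (mul_le_mul_of_nonneg_right hφU
          (integral_nonneg fun ω => (inv_pos.2 (hUpos ω)).le))) (Real.exp_pos _).le
    _ ≤ ((∫ ω, Real.exp (-2 * (∑ j ∈ T, h j ω + r ω)) ∂π) *
          Real.exp (-(∑ j ∈ T, Real.exp (-4 * M j) *
            (∫ ω, (coordAvg μ (Finset.univ \ s) (h j) ω - ∫ ω', h j ω' ∂π) ^ 2 ∂π) / (1 + M j ^ 2)))) *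
        Real.exp (∑ j ∈ T, Real.exp (-4 * M j) *
          (∫ ω, (coordAvg μ (Finset.univ \ s) (h j) ω - ∫ ω', h j ω' ∂π) ^ 2 ∂π) / (1 + M j ^ 2)) :=
        mul_le_mul_of_nonneg_right (mul_le_mul_of_nonneg_left hUle hE2) (Real.exp_pos _).le
    _ = ∫ ω, Real.exp (-2 * (∑ j ∈ T, h j ω + r ω)) ∂π := by
        rw [mul_assoc, ← Real.exp_add, neg_add_cancel, Real.exp_zero, mul_one]

/-- **The same for an approximately block-local log-weight**: if `|F − (Σ_j h_j + r)| ≤ δ` pointwise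
(continuous `F`), then `(∫e^{−F})²·exp(Σ_j e^{−4M_j}Var(A_C h_j)/(1 + M_j²)) ≤ e^{4δ}·∫e^{−2F}` — the
effective-sample-size fraction `(∫e^{−F})²/∫e^{−2F}` of the weights `e^{−F}` is at most
`e^{4δ}·Π_j exp(−e^{−4M_j}Var(A_C h_j)/(1 + M_j²))`. -/
theorem sq_integral_exp_neg_mul_exp_le_of_abs_sub_le {J : Type*} (T : Finset J) (B D : J → Finset ι)
    (hBD : ∀ j ∈ T, B j ⊆ D j) (hD : ∀ j ∈ T, ∀ j' ∈ T, j ≠ j' → Disjoint (D j) (D j'))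
    {h : J → (ι → X) → ℝ} (hc : ∀ j ∈ T, Continuous (h j)) (hdep : ∀ j ∈ T, DependsOn (h j) ↑(D j))
    {M : J → ℝ} (hM0 : ∀ j ∈ T, 0 ≤ M j) (hM : ∀ j ∈ T, ∀ ω ω', |h j ω - h j ω'| ≤ M j)
    {r : (ι → X) → ℝ} (hr : Continuous r) (hrdep : DependsOn r (↑(T.biUnion B) : Set ι)ᶜ)
    {F : (ι → X) → ℝ} (hF : Continuous F) {δ : ℝ} (hδ : ∀ ω, |F ω - (∑ j ∈ T, h j ω + r ω)| ≤ δ) :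
    (∫ ω, Real.exp (-F ω) ∂Measure.pi (fun _ : ι => μ)) ^ 2 *
        Real.exp (∑ j ∈ T, Real.exp (-4 * M j) *
          (∫ ω, (coordAvg μ (Finset.univ \ T.biUnion B) (h j) ω -
              ∫ ω', h j ω' ∂Measure.pi (fun _ : ι => μ)) ^ 2 ∂Measure.pi (fun _ : ι => μ)) /
            (1 + M j ^ 2)) ≤
      Real.exp (4 * δ) * ∫ ω, Real.exp (-2 * F ω) ∂Measure.pi (fun _ : ι => μ) := by
  set π : Measure (ι → X) := Measure.pi (fun _ : ι => μ) with hπ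
  have hmain := sq_integral_exp_neg_blockSum_mul_exp_le μ T B D hBD hD hc hdep hM0 hM hr hrdep
  have hcS : Continuous fun ω => ∑ j ∈ T, h j ω + r ω := (continuous_finsetSum T fun j hj => hc j hj).add hr
  -- `∫e^{−F} ≤ e^{δ}∫e^{−(Σh+r)}` and `∫e^{−2(Σh+r)} ≤ e^{2δ}∫e^{−2F}`
  have h1 : ∫ ω, Real.exp (-F ω) ∂π ≤ Real.exp δ * ∫ ω, Real.exp (-(∑ j ∈ T, h j ω + r ω)) ∂π := by
    rw [← integral_const_mul]
    refine integral_mono (integrable_pi_of_continuous μ hF.neg.rexp)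
      ((integrable_pi_of_continuous μ hcS.neg.rexp).const_mul _) fun ω => ?_
    show Real.exp (-F ω) ≤ Real.exp δ * Real.exp (-(∑ j ∈ T, h j ω + r ω))
    rw [← Real.exp_add]
    exact Real.exp_le_exp.2 (by linarith [(abs_le.1 (hδ ω)).1])
  have h2 : ∫ ω, Real.exp (-2 * (∑ j ∈ T, h j ω + r ω)) ∂π ≤ Real.exp (2 * δ) * ∫ ω, Real.exp (-2 * F ω) ∂π := by
    rw [← integral_const_mul]
    refine integral_mono (integrable_pi_of_continuous μ (continuous_const.mul hcS).rexp)
      ((integrable_pi_of_continuous μ (continuous_const.mul hF).rexp).const_mul _) fun ω => ?_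
    show Real.exp (-2 * (∑ j ∈ T, h j ω + r ω)) ≤ Real.exp (2 * δ) * Real.exp (-2 * F ω)
    rw [← Real.exp_add]
    exact Real.exp_le_exp.2 (by linarith [(abs_le.1 (hδ ω)).2])
  have hE0 : 0 ≤ ∫ ω, Real.exp (-F ω) ∂π := integral_nonneg fun ω => (Real.exp_pos _).le
  have hX0 : 0 ≤ Real.exp (∑ j ∈ T, Real.exp (-4 * M j) *
      (∫ ω, (coordAvg μ (Finset.univ \ T.biUnion B) (h j) ω - ∫ ω', h j ω' ∂π) ^ 2 ∂π) / (1 + M j ^ 2)) :=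
    (Real.exp_pos _).le
  have e4 : Real.exp (4 * δ) = Real.exp δ ^ 2 * Real.exp (2 * δ) := by
    rw [← Real.exp_nat_mul, ← Real.exp_add]; ring_nf
  calc (∫ ω, Real.exp (-F ω) ∂π) ^ 2 * Real.exp (∑ j ∈ T, Real.exp (-4 * M j) *
          (∫ ω, (coordAvg μ (Finset.univ \ T.biUnion B) (h j) ω - ∫ ω', h j ω' ∂π) ^ 2 ∂π) / (1 + M j ^ 2))
      ≤ (Real.exp δ * ∫ ω, Real.exp (-(∑ j ∈ T, h j ω + r ω)) ∂π) ^ 2 *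
          Real.exp (∑ j ∈ T, Real.exp (-4 * M j) *
            (∫ ω, (coordAvg μ (Finset.univ \ T.biUnion B) (h j) ω - ∫ ω', h j ω' ∂π) ^ 2 ∂π) / (1 + M j ^ 2)) :=
        mul_le_mul_of_nonneg_right (pow_le_pow_left₀ hE0 h1 2) hX0
    _ = Real.exp δ ^ 2 * ((∫ ω, Real.exp (-(∑ j ∈ T, h j ω + r ω)) ∂π) ^ 2 *
          Real.exp (∑ j ∈ T, Real.exp (-4 * M j) *
            (∫ ω, (coordAvg μ (Finset.univ \ T.biUnion B) (h j) ω - ∫ ω', h j ω' ∂π) ^ 2 ∂π) / (1 + M j ^ 2))) := by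
        ring
    _ ≤ Real.exp δ ^ 2 * ∫ ω, Real.exp (-2 * (∑ j ∈ T, h j ω + r ω)) ∂π :=
        mul_le_mul_of_nonneg_left hmain (sq_nonneg _)
    _ ≤ Real.exp δ ^ 2 * (Real.exp (2 * δ) * ∫ ω, Real.exp (-2 * F ω) ∂π) :=
        mul_le_mul_of_nonneg_left h2 (sq_nonneg _)
    _ = Real.exp (4 * δ) * ∫ ω, Real.exp (-2 * F ω) ∂π := by rw [e4]; ring

end Summit.Ventures.LatticeQCDFlow.Exactness

end
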